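import Literature.Claims.NS.VasquezCampos2024
import Literature.Barriers.NavierStokesRegularity.SmallDataGlobalRegularityHomSobolev
import Summits.NavierStokesRegularity.NavierStokesRegularity.Theorems.SoloRefuteVasquezCampos2024
import Mathlib.Analysis.Fourier.LpSpace
import HarnessLib

/-!
# Solo salvage for claim C35 `VasquezCampos2024` (cell `ns-claims`, D-0090): the small-data step is a
# THEOREM for some constant — `∃ C > 0, SmallData C`

Claim skeleton: `Literature/Claims/NS/VasquezCampos2024.lean` (typist-8 g2, p479616/p480315); locator of record
(ADJUDICATED, refuter-7): the §2/§6 composition `GlueThreshold`/`CompositionRule` is false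
(`Theorems/SoloRefuteVasquezCampos2024.lean`, p484370). This file (seat `ns-claims-salvage-p2`, salvage lane
of C35) upgrades the salvage column's «`SmallData C` TRUE in substance for SOME constant — cite only» to a
kernel theorem: the paper's Steps 4–6 conclusion `SmallData C` («for `ν > (2C/π)‖max{1,|ξ|}² û⁰‖_{L¹⊕L²}`
the Clay datum `u⁰` has a Clay-sense solution at viscosity `ν`», Cor. 23/24 pp.27–28) HOLDS for
`C = π/(2δ)` with the tree's Fujita–Kato–Kato threshold `δ`
(`Literature.Barriers.NavierStokesRegularity.exists_clayA_of_small_homSobolevHalf`: small `Ḣ^{1/2}` Clay data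
are Clay-(A)-solvable), because the paper's weighted Fourier norm dominates the critical Sobolev seminorm:
`‖u⁰‖_{Ḣ^{1/2}} = (∫|ξ||𝓕u⁰|²)^{1/2} ≤ ‖max{1,|ξ|}² û⁰‖_{L²} ≤ ‖max{1,|ξ|}² û⁰‖_{L¹⊕L²}`
(`eHomSobolevSeminorm_half_le_eLpNorm_weightFn`; Plancherel-level identification of Mathlib's `L²` Fourier
transform with the Schwartz one, `SchwartzMap.toLp_fourier_eq`, and `𝓕⁻u(ξ) = 𝓕u(−ξ)`).

* `eHomSobolevSeminorm_half_le_eLpNorm_weightFn` — `‖u⁰‖_{Ḣ^{1/2}} ≤ ‖max{1,|ξ|}² û⁰‖_{L²}` for Clay data;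
* `smallData_holds : ∃ C, 0 < C ∧ SmallData C`.

So the claimed Theorem (v3 §1/Cor. 24), RESTRICTED to data below the printed threshold, is a true small-data
statement (the paper's own v4 §8 reading); what fails is only the scaling composition to all data (p484370).
Solo lane (`Theorems/SoloSalvage<Slug>….lean`, no item).

WHAT THIS IS NOT: not a claim about NS regularity or blow-up; not a claim about any author beyond the
typed locator.
-/

noncomputable section

-- The mandated landing namespace repeats the summit name by design (D-0017).
set_option linter.dupNamespace false

namespace Summit.NavierStokesRegularity.NavierStokesRegularity.Theorems.VasquezCampos2024

open MeasureTheory FourierTransform Set Filter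
open scoped SchwartzMap ENNReal NNReal ContDiff Topology
open Literature.Analysis.FluidPDE Literature.Claims.NS.VasquezCampos2024 Literature.Analysis.FunctionSpaces
open Literature.Analysis.FunctionSpaces (EuclideanSpace.complexify)

/-- **The critical Sobolev seminorm is dominated by the paper's weighted Fourier `L²` norm**: for a Clay
datum `u⁰`, `‖u⁰‖_{Ḣ^{1/2}} = (∫ |ξ| |𝓕u⁰(ξ)|² dξ)^{1/2} ≤ ‖max{1,|ξ|}² 𝓕⁻u⁰‖_{L²}` (`|ξ| ≤ max{1,|ξ|}⁴`,
`|𝓕u⁰(ξ)| = |𝓕⁻u⁰(−ξ)|`, Lebesgue measure is even). [cite: VasquezCampos2024, Cor. 23 l.2279–2316 p.27] -/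
theorem eHomSobolevSeminorm_half_le_eLpNorm_weightFn {u₀ : R3 → R3} (hs : ContDiff ℝ ∞ u₀)
    (hdec : HasRapidSpatialDecay u₀) :
    Function.eHomSobolevSeminorm (1 / 2 : ℝ) (EuclideanSpace.complexify ∘ u₀) ≤
      eLpNorm (weightFn 2 u₀) 2 volume := by
  set f : 𝓢(R3, C3) := datumSchwartz hs hdec with hf
  have hcoe : (EuclideanSpace.complexify ∘ u₀ : R3 → C3) = ⇑f := rfl
  have h2 : MemLp (⇑f) 2 (volume : Measure R3) := f.memLp 2 volume
  rw [hcoe, Function.eHomSobolevSeminorm, dif_pos h2]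
  have htoLp : h2.toLp ⇑f = f.toLp 2 := rfl
  rw [htoLp, Literature.Analysis.FunctionSpaces.eHomSobolevSeminorm, SchwartzMap.toLp_fourier_eq,
    eLpNorm_eq_lintegral_rpow_enorm_toReal two_ne_zero ENNReal.ofNat_ne_top]
  set g : 𝓢(R3, C3) := 𝓕 f with hg
  have hae : ((g.toLp 2 : Lp C3 2 (volume : Measure R3)) : R3 → C3) =ᵐ[volume] ⇑g :=
    SchwartzMap.coeFn_toLp _ _ _
  rw [lintegral_congr_ae (hae.mono fun ξ hξ => by rw [hξ])]
  have h22 : (2 : ℝ) * 2⁻¹ = 1 := by norm_num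
  simp only [ENNReal.toReal_ofNat, one_div, h22, ENNReal.rpow_one]
  refine ENNReal.rpow_le_rpow ?_ (by norm_num)
  -- pointwise: `‖ξ‖ ‖𝓕f(ξ)‖² ≤ (weightFn 2 u₀ (−ξ))²`, then evenness of Lebesgue measure
  have hhat : ∀ ξ : R3, hat u₀ (-ξ) = g ξ := fun ξ => by
    rw [hat_eq hs hdec, SchwartzMap.fourierInv_coe, hg, SchwartzMap.fourier_coe,
      Real.fourierInv_eq_fourier_neg, neg_neg]
  have hpt : ∀ ξ : R3, ‖ξ‖ₑ * ‖g ξ‖ₑ ^ 2 ≤ ‖weightFn 2 u₀ (-ξ)‖ₑ ^ (2 : ℝ) := by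
    intro ξ
    have hw0 : 0 ≤ weightFn 2 u₀ (-ξ) := by unfold weightFn; positivity
    rw [← ofReal_norm, ← ofReal_norm, ← ENNReal.ofReal_pow (norm_nonneg _),
      ← ENNReal.ofReal_mul (norm_nonneg _), Real.enorm_eq_ofReal hw0,
      ENNReal.ofReal_rpow_of_nonneg hw0 (by norm_num)]
    refine ENNReal.ofReal_le_ofReal ?_
    have hm1 : (1 : ℝ) ≤ max 1 ‖ξ‖ := le_max_left _ _
    have hm : ‖ξ‖ ≤ (max 1 ‖ξ‖) ^ (4 : ℕ) := (le_max_right _ _).trans (le_self_pow₀ hm1 (by norm_num))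
    unfold weightFn
    rw [norm_neg, hhat ξ, Real.rpow_two, Real.rpow_two]
    calc ‖ξ‖ * ‖g ξ‖ ^ 2 ≤ (max 1 ‖ξ‖) ^ (4 : ℕ) * ‖g ξ‖ ^ 2 := by gcongr
      _ = (max 1 ‖ξ‖ ^ 2 * ‖g ξ‖) ^ 2 := by ring
  have hmp : MeasurePreserving (fun ξ : R3 => -ξ) volume volume :=
    (LinearIsometryEquiv.neg ℝ : R3 ≃ₗᵢ[ℝ] R3).measurePreserving
  have hemb : MeasurableEmbedding (fun ξ : R3 => -ξ) :=
    (LinearIsometryEquiv.neg ℝ : R3 ≃ₗᵢ[ℝ] R3).toHomeomorph.measurableEmbedding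
  have hneg : ∫⁻ ξ : R3, ‖weightFn 2 u₀ (-ξ)‖ₑ ^ (2 : ℝ) = ∫⁻ ξ : R3, ‖weightFn 2 u₀ ξ‖ₑ ^ (2 : ℝ) :=
    hmp.lintegral_comp_emb hemb (fun η : R3 => ‖weightFn 2 u₀ η‖ₑ ^ (2 : ℝ))
  calc ∫⁻ ξ : R3, ‖ξ‖ₑ * ‖g ξ‖ₑ ^ 2 ≤ ∫⁻ ξ : R3, ‖weightFn 2 u₀ (-ξ)‖ₑ ^ (2 : ℝ) := lintegral_mono hpt
    _ = ∫⁻ ξ : R3, ‖weightFn 2 u₀ ξ‖ₑ ^ (2 : ℝ) := hneg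

/-- **`SmallData C` holds for some `C > 0`** (Steps 4–6 of C35 as a TRUE small-data theorem): with the
tree's threshold `δ` of `exists_clayA_of_small_homSobolevHalf` and `C := π/(2δ)`, every Clay datum with
`(2C/π)‖max{1,|ξ|}² û⁰‖_{L¹⊕L²} < ν` — i.e. `‖max{1,|ξ|}² û⁰‖_{L¹⊕L²} < δν` — has
`‖u⁰‖_{Ḣ^{1/2}} ≤ ‖max{1,|ξ|}² û⁰‖_{L²} < δν`, hence a Clay-sense solution at viscosity `ν`.
[cite: VasquezCampos2024, Cor. 23 (`vfastdecrease`) l.2279–2316 p.27; Cor. 24 l.2364–2371 p.28] -/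
theorem smallData_holds : ∃ C : ℝ, 0 < C ∧ SmallData C := by
  obtain ⟨δ, hδ, h⟩ := Literature.Barriers.NavierStokesRegularity.exists_clayA_of_small_homSobolevHalf
  refine ⟨Real.pi / (2 * δ), by positivity, fun ν hν u₀ hu hthr => ?_⟩
  obtain ⟨hs, hdiv, hdec⟩ := hu
  have hW : normW 2 u₀ < δ * ν := by
    have hc : 2 * (Real.pi / (2 * δ)) / Real.pi = δ⁻¹ := by
      field_simp
    unfold threshold at hthr
    rw [hc] at hthr
    rwa [inv_mul_lt_iff₀ hδ] at hthr
  have hsemi : Function.eHomSobolevSeminorm (1 / 2 : ℝ) (EuclideanSpace.complexify ∘ u₀) ≤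
      ENNReal.ofReal (δ * ν) := by
    refine (eHomSobolevSeminorm_half_le_eLpNorm_weightFn hs hdec).trans ?_
    have hfin := (eLpNorm_weightFn_lt_top hs hdec).2
    have h1 : 0 ≤ (eLpNorm (weightFn 2 u₀) 1 volume).toReal := ENNReal.toReal_nonneg
    calc eLpNorm (weightFn 2 u₀) 2 volume
        = ENNReal.ofReal (eLpNorm (weightFn 2 u₀) 2 volume).toReal := (ENNReal.ofReal_toReal hfin.ne).symm
      _ ≤ ENNReal.ofReal (normW 2 u₀) := ENNReal.ofReal_le_ofReal (by unfold normW; linarith)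
      _ ≤ ENNReal.ofReal (δ * ν) := ENNReal.ofReal_le_ofReal hW.le
  obtain ⟨u, p, hu, hp, hns, hE⟩ := h ν hν u₀ hs hdiv hdec hsemi
  exact ⟨u, p, hu, hp, hns, hE⟩

end Summit.NavierStokesRegularity.NavierStokesRegularity.Theorems.VasquezCampos2024
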